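import Mathlib
import Summits.Ventures.PercRepro2.Defs
import Summits.Ventures.PercRepro2.Independence
import Summits.Ventures.PercRepro2.Harris
import Summits.Ventures.PercRepro2.Graph
import Summits.Ventures.PercRepro2.Exploration
import Summits.Ventures.PercRepro2.Events
import Summits.Ventures.PercRepro2.Statements
import Summits.Ventures.PercRepro2.FourFunctions
import Summits.Ventures.PercRepro2.Induced
import Summits.Ventures.PercRepro2.Frontier
import Summits.Ventures.PercRepro2.ObsIndependence
import Summits.Ventures.PercRepro2.BHK
import Summits.Ventures.PercRepro2.BHKEvents

/-!
# BHK for monotone cluster properties (blind cell PercRepro2, p1)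

The two van den Berg–Häggström–Kahn inequalities for *monotone cluster properties* in the sense of
Kozma–Nitzan (`IsMonotoneClusterProperty`, Statements.lean: `f x ω` depends monotonically on the
cluster `C_ω(x)` and is constant along open edges), in the unconditional form with `D = {s ↮ t}`:

* `bhk_same_cluster_fun` (BHK06 Thm 1.3): `E[f(s) 1_D] · E[f'(s) 1_D] ≤ E[f(s) f'(s) 1_D] · P(D)`;
* `bhk_cross_cluster_fun` (BHK06 Thm 1.4): `E[f(s) f'(t) 1_D] · P(D) ≤ E[f(s) 1_D] · E[f'(t) 1_D]`,

for nonnegative `f, f'`. The bridge to the set-functional form of `BHK.lean` is `Fof`: the value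
of `f` at `s` as a function of the cluster of `s` (well defined by monotonicity). The cross-cluster
inequality is obtained as in `BHKEvents.lean`: explore `C(s)`, `g(W) = E[f'(t) in G ∖ W]`
(`delExpect`) is antitone and bounded, apply the same-cluster inequality to `f(s)` and `c − g(C(s))`.
-/

namespace Summit.Ventures.PercRepro2

section Fof

variable {V : Type*} {E : Type*} {R : Type*} [Field R] [LinearOrder R]

/-- `Fof` evaluated on the cluster of `s` in `ω` is `f s ω`. -/
lemma Fof_cluster {ends : E → Sym2 V} {f : V → Config E → R}
    (hf : IsMonotoneClusterProperty ends f) (s : V) (ω : Config E) :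
    Fof ends f s (cluster ends ω s) = f s ω := by
  unfold Fof
  have h : ∃ ω' : Config E, cluster ends ω' s = cluster ends ω s := ⟨ω, rfl⟩
  rw [dif_pos h]
  have hc : cluster ends h.choose s = cluster ends ω s := h.choose_spec
  exact le_antisymm (hf.mono s _ _ hc.le) (hf.mono s _ _ hc.ge)

/-- `Fof` is monotone on the clusters of `s`. -/
lemma Fof_mono_on {ends : E → Sym2 V} {f : V → Config E → R}
    (hf : IsMonotoneClusterProperty ends f) (s : V) :
    ∀ ω ω' : Config E, cluster ends ω s ⊆ cluster ends ω' s →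
      Fof ends f s (cluster ends ω s) ≤ Fof ends f s (cluster ends ω' s) := by
  intro ω ω' h
  rw [Fof_cluster hf, Fof_cluster hf]
  exact hf.mono s ω ω' h

/-- `Fof` is nonnegative on the clusters of `s` when `f` is. -/
lemma Fof_nonneg_on {ends : E → Sym2 V} {f : V → Config E → R}
    (hf : IsMonotoneClusterProperty ends f) (s : V) (hf0 : ∀ ω, 0 ≤ f s ω) :
    ∀ ω : Config E, 0 ≤ Fof ends f s (cluster ends ω s) := by
  intro ω
  rw [Fof_cluster hf]
  exact hf0 ω

omit [Field R] in
/-- A monotone cluster property takes the same value at connected vertices. -/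
lemma IsMonotoneClusterProperty.eq_of_conn {ends : E → Sym2 V} {f : V → Config E → R}
    (hf : IsMonotoneClusterProperty ends f) {ω : Config E} {x y : V} (h : Conn ends ω x y) :
    f x ω = f y ω := by
  have key : y ∈ {z | f x ω = f z ω} := by
    refine mem_of_conn_of_closed (ends := ends) (ω := ω) ?_ rfl h
    intro u hu w huw
    obtain ⟨_, e, he, hends⟩ := openGraph_adj.1 huw
    rw [Set.mem_setOf_eq] at hu ⊢
    rw [hu]
    exact hf.eq_of_openAdj u w ω ⟨e, he, hends⟩
  exact key

omit [Field R] in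
/-- A monotone cluster property depends on the configuration only through the cluster. -/
lemma IsMonotoneClusterProperty.eq_of_cluster_eq {ends : E → Sym2 V} {f : V → Config E → R}
    (hf : IsMonotoneClusterProperty ends f) {ω ω' : Config E} {x : V}
    (h : cluster ends ω x = cluster ends ω' x) : f x ω = f x ω' :=
  le_antisymm (hf.mono x ω ω' h.le) (hf.mono x ω' ω h.ge)

end Fof

section SameCluster

variable {V : Type*} {E : Type*} [Fintype E] [DecidableEq E] [Fintype V] [DecidableEq V]
  {R : Type*} [Field R] [LinearOrder R] [IsStrictOrderedRing R]

/-- **BHK, same cluster, for cluster properties** (BHK06 Thm 1.3): for nonnegative monotone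
cluster properties `f, f'`, `E[f(s) 1_D] · E[f'(s) 1_D] ≤ E[f(s) f'(s) 1_D] · P(D)`, `D = {s ↮ t}`. -/
theorem bhk_same_cluster_fun (p : E → R) (hp : IsProbVec p) (ends : E → Sym2 V) (s t : V)
    {f f' : V → Config E → R} (hf : IsMonotoneClusterProperty ends f)
    (hf' : IsMonotoneClusterProperty ends f') (hf0 : ∀ ω, 0 ≤ f s ω) (hf'0 : ∀ ω, 0 ≤ f' s ω) :
    expect p (fun ω => f s ω * ((connEvent ends s t)ᶜ).indicator 1 ω) *
        expect p (fun ω => f' s ω * ((connEvent ends s t)ᶜ).indicator 1 ω) ≤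
      expect p (fun ω => f s ω * f' s ω * ((connEvent ends s t)ᶜ).indicator 1 ω) *
        prob p (connEvent ends s t)ᶜ := by
  have h := bhk_induced' p hp ends s (Fof_mono_on hf s) (Fof_mono_on hf' s) (Fof_nonneg_on hf s hf0)
    (Fof_nonneg_on hf' s hf'0) Finset.univ {t} {t} (Finset.subset_univ _) (Finset.subset_univ _)
  simp only [Finset.inter_self, Finset.union_self, REvent_univ_singleton] at h
  have e : ∀ F : Set V → R, clusterObs ends Finset.univ s F * ((connEvent ends s t)ᶜ).indicator 1 =
      fun ω => F (cluster ends ω s) * ((connEvent ends s t)ᶜ).indicator 1 ω := by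
    intro F
    funext ω
    simp only [Pi.mul_apply, clusterObs_apply, clusterIn_univ]
  rw [e, e, e] at h
  simp only [Pi.mul_apply, Fof_cluster hf, Fof_cluster hf'] at h
  exact h

end SameCluster

section CrossCluster

variable {V : Type*} {E : Type*} [Fintype E] [DecidableEq E] [Fintype V] [DecidableEq V]
  {R : Type*} [Field R] [LinearOrder R] [IsStrictOrderedRing R]

omit [Fintype V] [DecidableEq V] in
/-- For a monotone cluster property, `g` is antitone in `W`. -/
lemma delExpect_anti (p : E → R) (hp : IsProbVec p) (ends : E → Sym2 V) {f : V → Config E → R}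
    (hf : IsMonotoneClusterProperty ends f) (t : V) : Antitone (delExpect p ends f t) := by
  intro W W' h
  unfold delExpect
  refine expect_mono hp fun ω => ?_
  exact hf.mono t _ _ (cluster_mono (delConfig_anti h ω) t)

omit [Fintype V] [DecidableEq V] in
/-- `g` is bounded by any bound of `f(t)`. -/
lemma delExpect_le (p : E → R) (hp : IsProbVec p) (ends : E → Sym2 V) (f : V → Config E → R)
    (t : V) {c : R} (hc : ∀ ω, f t ω ≤ c) (W : Set V) : delExpect p ends f t W ≤ c := by
  unfold delExpect
  have := expect_mono hp (f := fun ω => f t (delConfig ends W ω)) (g := fun _ => c)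
    fun ω => hc _
  simpa using this

omit [Fintype V] [DecidableEq V] in
/-- `g ≥ 0` when `f(t) ≥ 0`. -/
lemma delExpect_nonneg (p : E → R) (hp : IsProbVec p) (ends : E → Sym2 V) (f : V → Config E → R)
    (t : V) (hf0 : ∀ ω, 0 ≤ f t ω) (W : Set V) : 0 ≤ delExpect p ends f t W :=
  expect_nonneg hp fun _ => hf0 _

omit [DecidableEq V] [IsStrictOrderedRing R] in
/-- **Exploring the cluster of `s`, functional form**: for a monotone cluster property `f'`,
`E[f(s) f'(t) 1_D] = E[f(s) · g(C(s)) · 1_D]` with `g = delExpect p ends f' t`, for any `f`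
depending on the configuration only through `C(s)` (via `Fof`). -/
theorem expect_mul_eq_expect_delExpect (p : E → R) (ends : E → Sym2 V) (s t : V)
    (F : Set V → R) {f' : V → Config E → R} (hf' : IsMonotoneClusterProperty ends f') :
    expect p (fun ω => F (cluster ends ω s) * f' t ω * ((connEvent ends s t)ᶜ).indicator 1 ω) =
      expect p (fun ω => F (cluster ends ω s) * delExpect p ends f' t (cluster ends ω s) *
        ((connEvent ends s t)ᶜ).indicator 1 ω) := by
  classical
  let c : Set V → R := fun W => F W * ({W' : Set V | t ∉ W'}.indicator 1 W)
  let Φ : Set V → Config E → R := fun W ω => c W * f' t (delConfig ends W ω)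
  have hΦ : ∀ W, DependsOn (Φ W) (touches ends W)ᶜ := by
    intro W ω ω' h
    simp only [Φ]
    rw [delConfig_congr h]
  have hS : ∀ W : Set V, DependsOn (· ∈ {ω | cluster ends ω s = W}) (touches ends W) :=
    fun W => dependsOn_clusterEvent ends s W
  have hdisj : ∀ W : Set V, Disjoint (touches ends W) (touches ends W)ᶜ :=
    fun W => disjoint_compl_right
  have hpt : ∀ ω, F (cluster ends ω s) * f' t ω * ((connEvent ends s t)ᶜ).indicator 1 ω =
      Φ (cluster ends ω s) ω := by
    intro ω
    simp only [Φ, c]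
    by_cases hst : t ∈ cluster ends ω s
    · rw [Set.indicator_of_notMem (show cluster ends ω s ∉ {W' : Set V | t ∉ W'} from fun h => h hst),
        Set.indicator_of_notMem (show ω ∉ (connEvent ends s t)ᶜ from fun h => h hst)]
      simp
    · have e := cluster_delConfig_cluster (ends := ends) (ω := ω) (s := s) hst
      rw [Set.indicator_of_mem (show cluster ends ω s ∈ {W' : Set V | t ∉ W'} from hst),
        Set.indicator_of_mem (show ω ∈ (connEvent ends s t)ᶜ from hst),
        hf'.eq_of_cluster_eq e.symm]
      simp
  have hΦexp : ∀ W, expect p (Φ W) = c W * delExpect p ends f' t W := by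
    intro W
    simp only [Φ]
    rw [expect_const_mul]
    rfl
  have e1 : (fun ω => F (cluster ends ω s) * f' t ω * ((connEvent ends s t)ᶜ).indicator 1 ω) =
      fun ω => Φ (cluster ends ω s) ω := funext hpt
  rw [e1, expect_tower p hdisj (S := fun ω => cluster ends ω s) hS hΦ]
  simp only [hΦexp]
  unfold expect
  refine Finset.sum_congr rfl fun ω _ => ?_
  simp only [c]
  by_cases hst : t ∈ cluster ends ω s
  · rw [Set.indicator_of_notMem (show cluster ends ω s ∉ {W' : Set V | t ∉ W'} from fun h => h hst),
      Set.indicator_of_notMem (show ω ∉ (connEvent ends s t)ᶜ from fun h => h hst)]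
    simp
  · rw [Set.indicator_of_mem (show cluster ends ω s ∈ {W' : Set V | t ∉ W'} from hst),
      Set.indicator_of_mem (show ω ∈ (connEvent ends s t)ᶜ from hst)]
    simp

/-- **BHK, different clusters, for cluster properties** (BHK06 Thm 1.4): for monotone cluster
properties `f, f'` with `f(s) ≥ 0`,
`E[f(s) f'(t) 1_D] · P(D) ≤ E[f(s) 1_D] · E[f'(t) 1_D]`, `D = {s ↮ t}`. -/
theorem bhk_cross_cluster_fun (p : E → R) (hp : IsProbVec p) (ends : E → Sym2 V) (s t : V)
    {f f' : V → Config E → R} (hf : IsMonotoneClusterProperty ends f)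
    (hf' : IsMonotoneClusterProperty ends f') (hf0 : ∀ ω, 0 ≤ f s ω) :
    expect p (fun ω => f s ω * f' t ω * ((connEvent ends s t)ᶜ).indicator 1 ω) *
        prob p (connEvent ends s t)ᶜ ≤
      expect p (fun ω => f s ω * ((connEvent ends s t)ᶜ).indicator 1 ω) *
        expect p (fun ω => f' t ω * ((connEvent ends s t)ᶜ).indicator 1 ω) := by
  classical
  -- a bound for `f'(t)`
  obtain ⟨c, hc⟩ : ∃ c : R, ∀ ω, f' t ω ≤ c :=
    ⟨Finset.univ.sup' Finset.univ_nonempty (fun ω => f' t ω),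
      fun ω => Finset.le_sup' (fun ω => f' t ω) (Finset.mem_univ ω)⟩
  set g := delExpect p ends f' t with hg
  have hg_anti : Antitone g := delExpect_anti p hp ends hf' t
  have hg_le : ∀ W, g W ≤ c := delExpect_le p hp ends f' t hc
  -- the two tower identities
  have eff := expect_mul_eq_expect_delExpect p ends s t (Fof ends f s) hf'
  have e1f := expect_mul_eq_expect_delExpect p ends s t (fun _ => (1 : R)) hf'
  simp only [Fof_cluster hf, one_mul] at eff e1f
  -- the same-cluster inequality with `F₁ = Fof f s`, `F₂ = c − g`
  have hF₂mono : ∀ ω ω' : Config E, cluster ends ω s ⊆ cluster ends ω' s →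
      (fun W => c - g W) (cluster ends ω s) ≤ (fun W => c - g W) (cluster ends ω' s) :=
    fun ω ω' h => by
      show c - g (cluster ends ω s) ≤ c - g (cluster ends ω' s)
      linarith [hg_anti h]
  have hF₂0 : ∀ ω : Config E, 0 ≤ (fun W => c - g W) (cluster ends ω s) := fun ω => by
    show 0 ≤ c - g (cluster ends ω s)
    linarith [hg_le (cluster ends ω s)]
  have key := bhk_induced' p hp ends s (F₁ := Fof ends f s) (F₂ := fun W => c - g W)
    (Fof_mono_on hf s) hF₂mono (Fof_nonneg_on hf s hf0) hF₂0 Finset.univ {t} {t}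
    (Finset.subset_univ _) (Finset.subset_univ _)
  simp only [Finset.inter_self, Finset.union_self, REvent_univ_singleton] at key
  have e : ∀ F : Set V → R, clusterObs ends Finset.univ s F * ((connEvent ends s t)ᶜ).indicator 1 =
      fun ω => F (cluster ends ω s) * ((connEvent ends s t)ᶜ).indicator 1 ω := by
    intro F
    funext ω
    simp only [Pi.mul_apply, clusterObs_apply, clusterIn_univ]
  rw [e, e, e] at key
  simp only [Pi.mul_apply, Fof_cluster hf] at key
  -- rewrite the expectations
  have eR : prob p (connEvent ends s t)ᶜ =
      expect p fun ω => ((connEvent ends s t)ᶜ).indicator 1 ω := prob_eq_expect_indicator p _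
  have e2 : expect p (fun ω => (c - g (cluster ends ω s)) * ((connEvent ends s t)ᶜ).indicator 1 ω) =
      c * prob p (connEvent ends s t)ᶜ -
        expect p (fun ω => f' t ω * ((connEvent ends s t)ᶜ).indicator 1 ω) := by
    rw [e1f, eR, ← expect_const_mul, ← expect_sub]
    congr 1
    funext ω
    simp only [Pi.sub_apply]
    ring
  have e3 : expect p (fun ω => f s ω * (c - g (cluster ends ω s)) *
      ((connEvent ends s t)ᶜ).indicator 1 ω) =
      c * expect p (fun ω => f s ω * ((connEvent ends s t)ᶜ).indicator 1 ω) -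
        expect p (fun ω => f s ω * f' t ω * ((connEvent ends s t)ᶜ).indicator 1 ω) := by
    rw [eff, ← expect_const_mul, ← expect_sub]
    congr 1
    funext ω
    simp only [Pi.sub_apply]
    ring
  rw [e2, e3] at key
  nlinarith [key]

end CrossCluster

end Summit.Ventures.PercRepro2
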